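/-
Copyright (c) 2026 the pub-hodgecm-mathlib formalisation cell (harness21).  Prover seat hodgecm-mathlib-LH4-p08 (g4), Track A «(D-RAM) FOUR-FRAME», unit U2H, the census leaf
(ρ2b′-X) `stub_U2H_fixedPointCensus_typeTwo_unit0` — dealer LH4-plan (g12) WORD #16∕#21 hand T5a «TORIC LEVEL CENSUS» (payer LH4-p14; plan owner LH4-p12 (g4)):
the TOP CELLS of the depth-refined census (the ω-sensitive half of the diagonal): PREPARATORY LEMMAS shared by both sides.  2026-09-04.
-/
import Summits.HodgeConjecture.HodgeConjecture.Theorems.F0P3cDyRamToricLevelCensusUnr        -- ★ p857436 (this seat): (UNR-hyper) head, `[U_M : B_k] = q^{⌊(k+1−d)∕2⌋}`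
import Summits.HodgeConjecture.HodgeConjecture.Theorems.F0P3cDyRamToricLevelCensusUnrDep     -- ★ p857473 (this seat): `dep_iff_of_witness`, depth unit, generator twist depth
import HarnessLib

/-!
# T5a: the TOP cells of the depth-refined level census — preparatory lemmas (both sides)

On the diagonal `j + m = jλ + a` with `e := 2a − m ≥ 1` the depth condition `μΛ^# ⊆ Λ` of a member `x₀𝒪_j` of `levelSet(j,a)` reads `|θ(x₀) + κ| ≤ exp(−s₀)`,
`s₀ := j + a − m`, `θ(x₀) = (ρh∕h)·t(x₀)`, `t(x) = ρN(x)∕N(x)`, `κ = ρμ∕μ` (★ `dep_iff_of_witness` + ★ `v_depthUnit_sub_map_eq`: `(1 + θ) + (κ − 1) = θ + κ`), i.e.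
`|1 + (η∕κ)·t(x₀)| ≤ exp(−s₀)` — a condition BLIND to `ϖE^k` (`t(ϖE^k ω) = t(ω)`) and cutting out, inside the units, a TRANSLATE `ω₁·B_{s₀}` of the norm-depth subgroup
by ANY solution `ω₁` (approximate translation lemma), on which the level clause `|1 + η t| = exp(a − j)` is automatic.  This file proves exactly these bookkeeping
sentences and the generator-class form of `#levelSetDep`; the counts (hyperbolic ∕ anisotropic top cells) are the next two files.
HONEST LABEL: HC_CM is proved only modulo the 7 printed citations (2 remaining named inputs: hLiu418 = stmt-HodgeConjecture-24832,
h413 = stmt-HodgeConjecture-24833) until rung 0 closes; (ρ2b′-X) :418 is an OPEN prover target — this file is a helper (`--supports`), proofs only.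
-/

set_option autoImplicit false

open WithZero IsLocalRing
open scoped Valued Pointwise

namespace Summit.HodgeConjecture.HodgeConjecture.Cruxes.H413.F0P3cDyRamToricLevelCensusUnr

open Summit.HodgeConjecture.HodgeConjecture.Cruxes.H413.F0P3cDyRamToricCensusDefs
open Literature.NumberTheory.LocalFields.QuadraticOrder Literature.NumberTheory.LocalFields.WildQuadraticDatum

variable {K : Type*} [Field K] [Valued K ℤᵐ⁰] {ρ Θ : K →+* K} {α ϖE h : K} {d q : ℕ}
variable {K' : Type*} [Field K'] [Valued K' ℤᵐ⁰] {σ' : K' →+* K'} {π' : K'}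

/-! ## §1 Bookkeeping: the twist is blind to `ϖE^k`, the approximate translation lemma, generator classes of `levelSetDep` -/

omit [Valued K ℤᵐ⁰] in
/-- `N_Θ(ϖE^k·ω) = N_Θ(ϖE)^k·N_Θ(ω)` and `N_Θ(ϖE)` is `ρ`-fixed (`ρϖE = ϖE`, `Θρ = ρΘ`), so **the twist `t(x) = ρN(x)∕N(x)` is blind to `ϖE^k`**:
`t(ϖE^k·ω) = t(ω)`. [cite: Jacobowitz1962, §4] -/
theorem twist_varpi_zpow_mul (hΘρ : ∀ x, Θ (ρ x) = ρ (Θ x)) (hρϖE : ρ ϖE = ϖE) (hϖ0 : ϖE ≠ 0) (k : ℤ) (ω : K) :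
    ρ (ϖE ^ k * ω * Θ (ϖE ^ k * ω)) / (ϖE ^ k * ω * Θ (ϖE ^ k * ω)) = ρ (ω * Θ ω) / (ω * Θ ω) := by
  have hΘϖ0 : Θ ϖE ≠ 0 := (map_ne_zero Θ).2 hϖ0
  have hρΘϖ : ρ (Θ ϖE) = Θ ϖE := by rw [← hΘρ, hρϖE]
  have hP0 : (ϖE * Θ ϖE) ^ k ≠ 0 := zpow_ne_zero _ (mul_ne_zero hϖ0 hΘϖ0)
  have hre : ϖE ^ k * ω * Θ (ϖE ^ k * ω) = (ϖE * Θ ϖE) ^ k * (ω * Θ ω) := by rw [map_mul, map_zpow₀, mul_zpow]; ring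
  rw [hre, map_mul, map_zpow₀, map_mul, hρϖE, hρΘϖ, mul_div_mul_left _ _ hP0]

/-- **THE APPROXIMATE TRANSLATION LEMMA.**  For a twist coefficient `η'` and a unit `ω₁` with `|1 + η'·t(ω₁)| ≤ r`:
`{ω ∈ U_M : |1 + η'·t(ω)| ≤ r} = ω₁·B_r`, `B_r = {ω : |N(ω) − ρN(ω)| ≤ r}` (`1 + η't₁t' = (1 + η't₁)·t' + (1 − t')`, `|1 − t'| = |N' − ρN'|`). [cite: Serre1979, Ch. V §3] -/
theorem setOf_v_one_add_mul_twist_le_eq_smul_of_le (hvρ : ∀ x, Valued.v (ρ x) = Valued.v x) (hvΘ : ∀ x, Valued.v (Θ x) = Valued.v x)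
    {η' : K} {ω₁ : Kˣ} (hω₁ : Valued.v (ω₁ : K) = 1) {r : ℤᵐ⁰}
    (hη' : Valued.v (1 + η' * (ρ ((ω₁ : K) * Θ ω₁) / ((ω₁ : K) * Θ ω₁))) ≤ r) {B : Subgroup Kˣ}
    (hB : ∀ ω : Kˣ, ω ∈ B ↔ Valued.v (ω : K) = 1 ∧ Valued.v ((ω : K) * Θ ω - ρ ((ω : K) * Θ ω)) ≤ r) :
    {ω : Kˣ | Valued.v (ω : K) = 1 ∧ Valued.v (1 + η' * (ρ ((ω : K) * Θ ω) / ((ω : K) * Θ ω))) ≤ r} = ω₁ • (B : Set Kˣ) := by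
  ext ω
  rw [Set.mem_smul_set_iff_inv_smul_mem, smul_eq_mul, SetLike.mem_coe, hB, Set.mem_setOf_eq]
  -- write ω = ω₁·ω' with ω' = ω₁⁻¹ω
  set ω' : Kˣ := ω₁⁻¹ * ω with hω'
  have hωeq : (ω : K) = (ω₁ : K) * ω' := by rw [hω', Units.val_mul, Units.val_inv_eq_inv_val, mul_inv_cancel_left₀ ω₁.ne_zero]
  have hN1 : (ω₁ : K) * Θ ω₁ ≠ 0 := mul_ne_zero ω₁.ne_zero ((map_ne_zero Θ).2 ω₁.ne_zero)
  have hN' : (ω' : K) * Θ ω' ≠ 0 := mul_ne_zero ω'.ne_zero ((map_ne_zero Θ).2 ω'.ne_zero)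
  have hvω' : Valued.v (ω : K) = 1 ↔ Valued.v (ω' : K) = 1 := by rw [hωeq, map_mul, hω₁, one_mul]
  -- the twist is multiplicative
  have ht : ρ ((ω : K) * Θ ω) / ((ω : K) * Θ ω) =
      ρ ((ω₁ : K) * Θ ω₁) / ((ω₁ : K) * Θ ω₁) * (ρ ((ω' : K) * Θ ω') / ((ω' : K) * Θ ω')) := by
    rw [hωeq, map_mul Θ, div_mul_div_comm, ← map_mul ρ]; congr 1 <;> ring
  have hvt' : Valued.v (ρ ((ω' : K) * Θ ω') / ((ω' : K) * Θ ω')) = 1 := by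
    rw [map_div₀, hvρ, div_self ((Valuation.ne_zero_iff _).2 hN')]
  -- `1 + η' t₁ t' = (1 + η' t₁) t' + (1 − t')`
  have hsplit : 1 + η' * (ρ ((ω : K) * Θ ω) / ((ω : K) * Θ ω)) =
      (1 + η' * (ρ ((ω₁ : K) * Θ ω₁) / ((ω₁ : K) * Θ ω₁))) * (ρ ((ω' : K) * Θ ω') / ((ω' : K) * Θ ω')) +
        (1 - ρ ((ω' : K) * Θ ω') / ((ω' : K) * Θ ω')) := by
    rw [ht]; ring
  have h1t : ∀ hv : Valued.v (ω' : K) = 1, Valued.v (1 - ρ ((ω' : K) * Θ ω') / ((ω' : K) * Θ ω')) =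
      Valued.v ((ω' : K) * Θ ω' - ρ ((ω' : K) * Θ ω')) := fun hv => by
    have hvN : Valued.v ((ω' : K) * Θ ω') = 1 := by rw [map_mul, hvΘ, hv, mul_one]
    rw [one_sub_div hN', map_div₀, hvN, div_one]
  constructor
  · rintro ⟨hv, hle⟩
    have hv' := hvω'.1 hv
    refine ⟨hv', ?_⟩
    rw [← h1t hv']
    have : 1 - ρ ((ω' : K) * Θ ω') / ((ω' : K) * Θ ω') =
        (1 + η' * (ρ ((ω : K) * Θ ω) / ((ω : K) * Θ ω))) -
          (1 + η' * (ρ ((ω₁ : K) * Θ ω₁) / ((ω₁ : K) * Θ ω₁))) * (ρ ((ω' : K) * Θ ω') / ((ω' : K) * Θ ω')) := by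
      rw [hsplit]; ring
    rw [this]
    refine (Valuation.map_sub _ _ _).trans (max_le hle ?_)
    rw [map_mul, hvt', mul_one]; exact hη'
  · rintro ⟨hv', hle⟩
    refine ⟨hvω'.2 hv', ?_⟩
    rw [hsplit]
    refine (Valuation.map_add _ _ _).trans (max_le ?_ ?_)
    · rw [map_mul, hvt', mul_one]; exact hη'
    · rw [h1t hv']; exact hle

/-- **`θ + κ = κ·(1 + (η∕κ)·t)`** bookkeeping: `|θ(ω) + κ| = |1 + (η∕κ)·t(ω)|` for a unit `κ` (`θ = η·t`). [cite: Jacobowitz1962, §4] -/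
theorem v_twist_add_eq (η t : K) {κ : K} (hκ : Valued.v κ = 1) :
    Valued.v (η * t + κ) = Valued.v (1 + η / κ * t) := by
  have hκ0 : κ ≠ 0 := fun h0 => by rw [h0, map_zero] at hκ; exact zero_ne_one hκ
  have : η * t + κ = κ * (1 + η / κ * t) := by field_simp; ring
  rw [this, map_mul, hκ, one_mul]


/-! ## §2 The depth condition on the top diagonal, read on a generator -/

/-- **TOP-CELL FORM OF THE DEPTH CONDITION.**  On the diagonal's top half (`a ≤ m < j + a`) the ★ `dep_iff_of_witness` clause for a generator `x₀` with `|y| = |ϖE|^a`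
is `|1 + (η∕κ)·t(x₀)| ≤ exp(−(j + a − m))` (`η = ρh∕h`, `κ = ρμ∕μ`, `t(x₀) = ρN(x₀)∕N(x₀)`). [cite: Jacobowitz1962, §4] [cite: Serre1979, Ch. V §3] -/
theorem dep_top_iff (hρρ : ∀ x, ρ (ρ x) = x) (hvρ : ∀ x, Valued.v (ρ x) = Valued.v x)
    (hρϖE : ρ ϖE = ϖE) (hϖE : Valued.v ϖE = exp (-1 : ℤ)) (hh : h ≠ 0)
    {μ : K} {m jl : ℕ} (hm : Valued.v μ = exp (-(m : ℤ))) (hjl : Valued.v (μ - ρ μ) = exp (-(jl : ℤ)))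
    {j a : ℕ} (ham : a ≤ m) (hma : m < j + a) {x₀ : K} (hx₀ : x₀ ≠ 0) (hΘx₀ : Θ x₀ ≠ 0)
    (hya : Valued.v (h * (x₀ * Θ x₀) * (ϖE ^ j * (α - ρ α))) = Valued.v ϖE ^ a) :
    (a ≤ m ∧ (j + a ≤ m ∨
        Valued.v (μ / (h * (x₀ * Θ x₀) * (ϖE ^ j * (α - ρ α)) * ϖE ^ (m - a)) - ρ (μ / (h * (x₀ * Θ x₀) * (ϖE ^ j * (α - ρ α)) * ϖE ^ (m - a)))) ≤
          exp (-((j + a : ℕ) - (m : ℤ))))) ↔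
      Valued.v (1 + ρ h / h / (ρ μ / μ) * (ρ (x₀ * Θ x₀) / (x₀ * Θ x₀))) ≤ exp (-((j + a : ℕ) - (m : ℤ))) := by
  have hμ0 : μ ≠ 0 := fun h0 => by rw [h0, map_zero] at hm; exact (exp_ne_zero hm.symm).elim
  have hκ : Valued.v (ρ μ / μ) = 1 := by rw [map_div₀, hvρ, div_self ((Valuation.ne_zero_iff _).2 hμ0)]
  obtain ⟨hz, -⟩ := v_depthUnit_sub_map_eq (Θ := Θ) (α := α) hρρ hvρ hρϖE hϖE hh hm hjl ham hx₀ hΘx₀ hya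
  have hring : (1 + ρ h / h * (ρ (x₀ * Θ x₀) / (x₀ * Θ x₀))) + (ρ μ / μ - 1) = ρ h / h * (ρ (x₀ * Θ x₀) / (x₀ * Θ x₀)) + ρ μ / μ := by ring
  rw [hz, hring, v_twist_add_eq _ _ hκ]
  constructor
  · rintro ⟨-, h1 | h2⟩
    · exfalso; omega
    · exact h2
  · exact fun h2 => ⟨ham, Or.inr h2⟩

/-- **THE LEVEL CLAUSE IS AUTOMATIC ON A TOP SOLUTION**: on the diagonal (`|κ − 1| = exp(a − j)`) with `e = 2a − m ≥ 1` (so `s₀ = j + a − m > j − a`), if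
`|1 + (η∕κ)t| ≤ exp(−s₀)` then `|1 + η·t| = exp(a − j)` (`1 + ηt = κ(1 + (η∕κ)t) + (1 − κ)`, strict ultrametric). [cite: Serre1979, Ch. V §3] -/
theorem v_one_add_twist_eq_of_top (hvρ : ∀ x, Valued.v (ρ x) = Valued.v x)
    {μ : K} {m jl : ℕ} (hm : Valued.v μ = exp (-(m : ℤ))) (hjl : Valued.v (μ - ρ μ) = exp (-(jl : ℤ)))
    {j a : ℕ} (hdiag : j + m = jl + a) (he : m < 2 * a) {η t : K}
    (htop : Valued.v (1 + η / (ρ μ / μ) * t) ≤ exp (-((j + a : ℕ) - (m : ℤ)))) :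
    Valued.v (1 + η * t) = exp ((a : ℤ) - j) := by
  have hμ0 : μ ≠ 0 := fun h0 => by rw [h0, map_zero] at hm; exact (exp_ne_zero hm.symm).elim
  have hρμ0 : ρ μ ≠ 0 := (map_ne_zero ρ).2 hμ0
  have hvμ0 : Valued.v μ ≠ 0 := (Valuation.ne_zero_iff _).2 hμ0
  have hκ : Valued.v (ρ μ / μ) = 1 := by rw [map_div₀, hvρ, div_self hvμ0]
  have h1κ : Valued.v (1 - ρ μ / μ) = exp ((a : ℤ) - j) := by
    rw [one_sub_div hμ0, map_div₀, hjl, hm, ← exp_sub]; congr 1; omega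
  have hsplit : 1 + η * t = ρ μ / μ * (1 + η / (ρ μ / μ) * t) + (1 - ρ μ / μ) := by field_simp; ring
  have hlt : Valued.v (ρ μ / μ * (1 + η / (ρ μ / μ) * t)) < Valued.v (1 - ρ μ / μ) := by
    rw [map_mul, hκ, one_mul, h1κ]
    exact htop.trans_lt (by rw [exp_lt_exp]; omega)
  rw [hsplit, Valuation.map_add_eq_of_lt_right _ hlt, h1κ]

/-- **THE BIT, UNIT FORM.**  With unit-norm surjectivity `hnorm`, the T5a top bit `∃ N (Θ-fixed unit), |η·(ρN∕N) + κ| ≤ r` is `∃ ω₁ ∈ U_M, |1 + (η∕κ)·t(ω₁)| ≤ r`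
(`N = ω₁Θω₁`; `|κ| = 1`). [cite: Serre1979, Ch. V §2] -/
theorem topBit_iff_exists_unit (hΘΘ : ∀ x, Θ (Θ x) = x) (hvΘ : ∀ x, Valued.v (Θ x) = Valued.v x)
    (hnorm : ∀ z : Kˣ, Θ (z : K) = z → Valued.v (z : K) = 1 → ∃ ω : Kˣ, Valued.v (ω : K) = 1 ∧ (ω : K) * Θ ω = z)
    (η : K) {κ : K} (hκ : Valued.v κ = 1) (r : ℤᵐ⁰) :
    (∃ N : K, Θ N = N ∧ Valued.v N = 1 ∧ Valued.v (η * (ρ N / N) + κ) ≤ r) ↔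
      ∃ ω₁ : Kˣ, Valued.v (ω₁ : K) = 1 ∧ Valued.v (1 + η / κ * (ρ ((ω₁ : K) * Θ ω₁) / ((ω₁ : K) * Θ ω₁))) ≤ r := by
  constructor
  · rintro ⟨N, hΘN, hN1, hle⟩
    have hN0 : N ≠ 0 := fun h0 => by rw [h0, map_zero] at hN1; exact zero_ne_one hN1
    obtain ⟨ω₁, hω₁, hωN⟩ := hnorm (Units.mk0 N hN0) (by rw [Units.val_mk0, hΘN]) (by rw [Units.val_mk0, hN1])
    rw [Units.val_mk0] at hωN
    refine ⟨ω₁, hω₁, ?_⟩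
    rw [hωN, ← v_twist_add_eq _ _ hκ]; exact hle
  · rintro ⟨ω₁, hω₁, hle⟩
    refine ⟨(ω₁ : K) * Θ ω₁, by rw [map_mul, hΘΘ, mul_comm], by rw [map_mul, hvΘ, hω₁, mul_one], ?_⟩
    rw [v_twist_add_eq _ _ hκ]; exact hle

/-! ## §3 `#levelSetDep` as generator classes -/

/-- **GENERATOR CLASSES OF `levelSetDep`**: `#levelSetDep(j,a;μ) = #(mk_{𝒪_jˣ} '' {x₀ : integral ∧ Gram-primitive ∧ level a ∧ ★ dep clause(x₀)})` (★ F1 + ★ `dep_iff_of_witness`).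
[cite: Jacobowitz1962, §4] -/
theorem ncard_levelSetDep_eq_ncard_image_mk (hρρ : ∀ x, ρ (ρ x) = x) (hvρ : ∀ x, Valued.v (ρ x) = Valued.v x) (hΘΘ : ∀ x, Θ (Θ x) = x)
    (hΘρ : ∀ x, Θ (ρ x) = ρ (Θ x)) (hvΘ : ∀ x, Valued.v (Θ x) = Valued.v x) (hα1 : Valued.v α ≤ 1) (hα : Valued.v (α - ρ α) = 1)
    (hρϖE : ρ ϖE = ϖE) (hϖE : Valued.v ϖE = exp (-1 : ℤ)) (hh : h ≠ 0)
    {μ : K} {m : ℕ} (hm : Valued.v μ = exp (-(m : ℤ))) {H : Subgroup Kˣ} (j a : ℕ)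
    (hH : ∀ u : Kˣ, u ∈ H ↔ Valued.v (u : K) = 1 ∧ Valued.v ((u : K) - ρ u) ≤ Valued.v (ϖE ^ j * (α - ρ α))) :
    (levelSetDep ρ Θ α ϖE h j a μ).ncard =
      ((QuotientGroup.mk : Kˣ → Kˣ ⧸ H) '' {x₀ : Kˣ |
        (((Valued.v (h * ((x₀ : K) * Θ x₀) * (ϖE ^ j * (α - ρ α))) ≤ 1 ∧
              Valued.v (h * ((x₀ : K) * Θ x₀) * (ϖE ^ j * (α - ρ α)) - ρ (h * ((x₀ : K) * Θ x₀) * (ϖE ^ j * (α - ρ α)))) ≤ Valued.v (ϖE ^ j * (α - ρ α))) ∧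
            ¬ (Valued.v (h * ((x₀ : K) * Θ x₀) * (ϖE ^ j * (α - ρ α)) / ϖE) ≤ 1 ∧
                Valued.v (h * ((x₀ : K) * Θ x₀) * (ϖE ^ j * (α - ρ α)) / ϖE - ρ (h * ((x₀ : K) * Θ x₀) * (ϖE ^ j * (α - ρ α)) / ϖE)) ≤
                  Valued.v (ϖE ^ j * (α - ρ α)))) ∧
          Valued.v (h * ((x₀ : K) * Θ x₀) * (ϖE ^ j * (α - ρ α))) = exp (-(a : ℤ))) ∧
        (a ≤ m ∧ (j + a ≤ m ∨
          Valued.v (μ / (h * ((x₀ : K) * Θ x₀) * (ϖE ^ j * (α - ρ α)) * ϖE ^ (m - a)) -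
              ρ (μ / (h * ((x₀ : K) * Θ x₀) * (ϖE ^ j * (α - ρ α)) * ϖE ^ (m - a)))) ≤ exp (-((j + a : ℕ) - (m : ℤ)))))}).ncard := by
  have hϖa : Valued.v ϖE ^ a = exp (-(a : ℤ)) := v_pow_eq_exp_neg hϖE a
  rw [← ncard_setOf_orderLattice_eq_ncard_image_mk hvρ hH]
  congr 1
  ext Λ
  constructor
  · rintro ⟨hL, hdep⟩
    obtain ⟨x₀, hx₀, hΛx, hyO, hyN, hya⟩ := hL
    have hQ := (dep_iff_of_witness hρρ hvρ hΘΘ hΘρ hvΘ hα1 hα hρϖE hϖE hh hm hx₀ hΛx hya).1 hdep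
    simp only [IsOrd, dualGen, hϖa] at hyO hyN hya hQ hΛx
    exact ⟨Units.mk0 x₀ hx₀, ⟨⟨⟨hyO, hyN⟩, hya⟩, hQ⟩, hΛx⟩
  · rintro ⟨x₀, ⟨⟨⟨hyO, hyN⟩, hya⟩, hQ⟩, hΛx⟩
    have hya' : Valued.v (dualGen ρ Θ α (ϖE ^ j) h x₀) = Valued.v ϖE ^ a := by rw [dualGen, hϖa]; exact hya
    have hΛx' : ∀ x, x ∈ Λ ↔ ∃ z, IsOrd ρ α (ϖE ^ j) z ∧ x = (x₀ : K) * z := hΛx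
    refine ⟨⟨(x₀ : K), x₀.ne_zero, hΛx', hyO, hyN, hya'⟩, ?_⟩
    exact (dep_iff_of_witness hρρ hvρ hΘΘ hΘρ hvΘ hα1 hα hρϖE hϖE hh hm x₀.ne_zero hΛx' hya').2 hQ

end Summit.HodgeConjecture.HodgeConjecture.Cruxes.H413.F0P3cDyRamToricLevelCensusUnr
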